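import Summits.QuantumFields.YangMills.Theorems.FluctuationComparisonRegPrIntLS2BetaComposedDilutionKernel
import HarnessLib

/-!
# S2β · (SCT″-c)₁ — «THE COMPOSED DILUTION KERNEL AS A FAMILY» (K5′ support): ONE family `K : (i : ℕ) → Site P i → Site P 0 → ℝ` with `K 0 = δ`, the RECURSION IDENTITY
# `K (i+1) y z = |I|⁻¹·Σ_a K i (base a y) z` EXPORTED, (K0)–(K4) at every level — so `y ↦ Σ_z K i y z·s z` is an EXACT solution of the pure lower-left rows for ANY level-0 data `s`;
# plus the abstract SUPERPOSITION lemma (rows with sources ⟹ below the sum of super-solutions started at each source level) — sources ride the kernel like data, no row sum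

Cell `ym3-torus` (YM ladder rung R3 = continuum `SU(2)` Yang–Mills on the three-torus at fixed lattice data — a RUNG: NOT d = 4, NOT infinite volume, NOT a mass gap,
NOT Clay).  Width seat «width 16» `ym3-torus-px16` (gen 23), S2β pairing-letter lane holder by lineage; crux `stmt-QuantumFields-20520`
(`…Theses.UnitScaleTilt.FluctuationComparisonRegPrIntL`), LINE g18-1 S2β.  `--kind proof --supports stmt-QuantumFields-20520 --as helper`, count-neutral, DEFINITION-FREE
(0 `def`, 0 `instance`, 0 `notation`, 0 `sorry`, default heartbeats); the family is packaged by `∃` and built by `Nat.rec` inside the proof.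

WHY (px13 g27 2026-08-31T19:26Z HAZARD «SRC-q»; ARCHITECT RULING px17 g22 19:27Z «(K5′) GO»).  ✓`exists_composedKernel`'s (K5) prices every source at the ROW SUM `(L²)^{n−j}` — sharp for
block-smooth sources, `×L^{3(n−j)}` too much for LOCALIZED ones (the quadratic chart remainder `q·M²` of a one-bond bump); the kernel part escapes exactly this through the dock
✓`dock_of_kernel` ∘ (★), and the sources must too: propagate them EXACTLY by the kernel and dock each source level like finest data (flatness `L^{m−1−4j}`, `n`-free at `d = 3`).
That needs two things ✓p831569 does not export: the kernels of consecutive levels LINKED by their recursion (so that kernel-propagated data solve the rows exactly), and a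
superposition principle.  THIS FILE gives both, cast-free: the family is indexed by the COARSE level with the fine level fixed at `0` (types `Site P i → Site P 0`); a source injected at
tower level `j` is finest data on the level-shifted torus `F.P (K − j)` (px13 g27 ✓`siteShift_blockIter_eq_blockOfIter`), where this file applies verbatim.

WHAT IS PROVED (sorry-free; `P : Params` generic, `μ ≠ ν`, standing range).
§1 ★★ `kernel_step` — the inductive step of ✓p831569 as a letter: (K0)(K2)(K3)(K4) at level `i` for `K` ⟹ (K0)–(K4) at `i+1` for `K⁺ y z := |I|⁻¹·Σ_a K (base a y) z`
   (`m = (d!)²L²∕|I|`; fiberwise counts ✓`sum_baseLL_le`∕✓`sum_sum_baseLL_le`, drift ✓`natAbs_rel_blockOf_le_two_of_baseLL`).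
§2 ★★★ `exists_kernelFamily (hμν) (r ≤ m+K)` : `∃ K : (i : ℕ) → Site P i → Site P 0 → ℝ`, `K 0 y z = if y = z then 1 else 0`, the RECURSION IDENTITY for `i < r`, and (K0)–(K4)
   for every `i ≤ r`.
§3 ★★ `superposition_le` — rows `ρ_{k+1}(y) ≤ |I|⁻¹Σ_a ρ_k(base a y) + src_{k+1}(y)` (`k < n`) and super-solutions `P j` started at the source levels (`ρ 0 ≤ P 0 0`, `src j ≤ P j j`,
   `|I|⁻¹Σ_a P j k (base a y) ≤ P j (k+1) y` for `j ≤ k < n`) ⟹ `ρ n y ≤ Σ_{j ≤ n} P j n y`; ★ `kernelSolution_row` — by §2's identity, `y ↦ Σ_z K k y z·s z` is an exact solution.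

HONEST SCOPE.  Finite torus combinatorics ∕ linear bookkeeping; nothing of Bałaban's analysis is asserted or proved ([Balaban1985Averaging] (19)–(20) p.21, Prop. 1 (51) p.26; [Balaban1987RG1]
(0.1)–(0.4) pp.251–253); (SCT″-c)₁₂₃, (LIFT-LAD′), NC-ROW′, (ST″), (ST), LOC″, (RSP), (BKG), h3 HYPOTHESES elsewhere; GAP♯∘ (`stub_uniformFibreGapOrbit`, registry untouched, 0∕5), S2β,
crux 20520, 19936, 19200 and `YM3TorusSU2` are NOT proved; no registered stub is closed; rung R3 = SU(2) YM₃ on T³ — NOT d = 4, NOT infinite volume, NOT a mass gap, NOT Clay; the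
Yang–Mills mass gap is NOT proved.
References: T. Bałaban, CMP **98** (1985) 17–51 [Balaban1985Averaging]; CMP **109** (1987) 249–301 [Balaban1987RG1].
-/

set_option autoImplicit false

noncomputable section

namespace Summit.QuantumFields.YangMills.Theorems.FluctuationComparisonRegPrIntLS2BetaComposedDilutionKernelFamily

open scoped BigOperators
open Finset
open Literature.MathematicalPhysics.QuantumFieldTheory.Balaban1983to89
open Literature.MathematicalPhysics.QuantumFieldTheory.Balaban1983to89.T4Continuum
open Literature.MathematicalPhysics.QuantumFieldTheory.Balaban1983to89.BlockAveraging (Idx)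
open Literature.MathematicalPhysics.QuantumFieldTheory.Balaban1983to89.B10Eq47AxialChi (shiftN shiftN_succ shiftN_zero)
open Literature.MathematicalPhysics.QuantumFieldTheory.Balaban1983to89.AveragingRT (blockSite_inj)
open B10Eq27TorusAxialLog (rel rel_apply rel_self rel_shift_of_le)
open B14.Eq22Determines (blockIter blockIter_zero blockIter_succ)
open Summit.QuantumFields.YangMills.Theorems.FluctuationComparisonRegPrIntLS2BetaCoarseCurlKernelCount (shiftN_left_injective)
open Summit.QuantumFields.YangMills.Theorems.FluctuationComparisonRegPrIntLS2BetaCoarseCurlLocal (blockOf_shiftN_shiftN_blockSite)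
open Summit.QuantumFields.YangMills.Theorems.FluctuationComparisonRegPrIntLS2BetaReadNesting (natAbs_rel_le_add natAbs_rel_blockOf_le_one)

open Summit.QuantumFields.YangMills.Theorems.FluctuationComparisonRegPrIntLS2BetaComposedDilutionKernel
  (card_triples sum_baseLL_le sum_sum_baseLL_le natAbs_rel_blockOf_le_two_of_baseLL)

variable {P : Params}

/-! ## §1 The inductive step as a letter -/

section Step

/-- ★★ **THE KERNEL STEP**: (K0), (K2), (K3), (K4) at level `i` for `K` ((K1) is not needed: the column sums carry it) give (K0)–(K4) at level `i+1` for the composed kernel `K⁺ y z := |I|⁻¹·Σ_a K (x_a(y)) z` (`x_a(y)` the lower-left base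
points of the `L × L` squares of the coarse plaquette at `y`). [cite: Balaban1985Averaging, (19)-(20) p.21, Prop. 1 (51) p.26; Balaban1987RG1, (0.1)-(0.4) pp.251-253] -/
theorem kernel_step {μ ν : Fin P.d} (hμν : μ ≠ ν) {i : ℕ} (hi : i + 1 ≤ P.m + P.K) (K : Site P i → Site P 0 → ℝ)
    (h0 : ∀ y z, 0 ≤ K y z)
    (h2 : ∀ z, ∑ y, K y z ≤ ((((Fintype.card (Equiv.Perm (Fin P.d))) ^ 2 * P.L ^ 2 : ℕ) : ℝ) / (Fintype.card (Idx P) : ℝ)) ^ i)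
    (h3 : ∀ y, ∑ z, K y z = ((P.L : ℝ) ^ 2) ^ i)
    (h4 : ∀ y z, K y z ≠ 0 → ∀ κ, (rel y (blockIter i z) κ).natAbs ≤ 2) :
    (∀ (y : Site P (i + 1)) (z : Site P 0), 0 ≤ (Fintype.card (Idx P) : ℝ)⁻¹ *
        ∑ a ∈ (Finset.univ : Finset (Idx P)) ×ˢ (Finset.range P.L ×ˢ Finset.range P.L), K (shiftN (shiftN (Site.blockSite y a.1.1) μ a.2.1) ν a.2.2) z) ∧
    (∀ (y : Site P (i + 1)) (z : Site P 0), (Fintype.card (Idx P) : ℝ)⁻¹ *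
        ∑ a ∈ (Finset.univ : Finset (Idx P)) ×ˢ (Finset.range P.L ×ˢ Finset.range P.L), K (shiftN (shiftN (Site.blockSite y a.1.1) μ a.2.1) ν a.2.2) z ≤
      ((((Fintype.card (Equiv.Perm (Fin P.d))) ^ 2 * P.L ^ 2 : ℕ) : ℝ) / (Fintype.card (Idx P) : ℝ)) ^ (i + 1)) ∧
    (∀ z : Site P 0, ∑ y : Site P (i + 1), (Fintype.card (Idx P) : ℝ)⁻¹ *
        ∑ a ∈ (Finset.univ : Finset (Idx P)) ×ˢ (Finset.range P.L ×ˢ Finset.range P.L), K (shiftN (shiftN (Site.blockSite y a.1.1) μ a.2.1) ν a.2.2) z ≤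
      ((((Fintype.card (Equiv.Perm (Fin P.d))) ^ 2 * P.L ^ 2 : ℕ) : ℝ) / (Fintype.card (Idx P) : ℝ)) ^ (i + 1)) ∧
    (∀ y : Site P (i + 1), ∑ z : Site P 0, (Fintype.card (Idx P) : ℝ)⁻¹ *
        ∑ a ∈ (Finset.univ : Finset (Idx P)) ×ˢ (Finset.range P.L ×ˢ Finset.range P.L), K (shiftN (shiftN (Site.blockSite y a.1.1) μ a.2.1) ν a.2.2) z =
      ((P.L : ℝ) ^ 2) ^ (i + 1)) ∧
    (∀ (y : Site P (i + 1)) (z : Site P 0), (Fintype.card (Idx P) : ℝ)⁻¹ *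
        ∑ a ∈ (Finset.univ : Finset (Idx P)) ×ˢ (Finset.range P.L ×ˢ Finset.range P.L), K (shiftN (shiftN (Site.blockSite y a.1.1) μ a.2.1) ν a.2.2) z ≠ 0 →
      ∀ κ, (rel y (blockIter (i + 1) z) κ).natAbs ≤ 2) := by
  classical
  -- abbreviations
  set A : Finset (Idx P × (ℕ × ℕ)) := (Finset.univ : Finset (Idx P)) ×ˢ (Finset.range P.L ×ˢ Finset.range P.L) with hA
  set cI : ℝ := (Fintype.card (Idx P) : ℝ) with hcI
  set C : ℝ := ((((Fintype.card (Equiv.Perm (Fin P.d))) ^ 2 * P.L ^ 2 : ℕ) : ℝ)) with hC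
  set mP : ℝ := C / cI with hmP
  have hcIpos : 0 < cI := by rw [hcI]; exact_mod_cast Fintype.card_pos
  have hC0 : 0 ≤ C := by rw [hC]; exact Nat.cast_nonneg _
  have hmPC : mP = cI⁻¹ * C := by rw [hmP, div_eq_inv_mul]
  have hmP0 : 0 ≤ mP := by rw [hmP]; exact div_nonneg hC0 hcIpos.le
  have hmem : ∀ a ∈ A, a.2.1 < P.L ∧ a.2.2 < P.L := fun a ha => by
    rw [hA, Finset.mem_product, Finset.mem_product, Finset.mem_range, Finset.mem_range] at ha; exact ha.2
  have hcardA : (A.card : ℝ) = cI * (P.L : ℝ) ^ 2 := by rw [hA, card_triples, hcI]; push_cast; ring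
  refine ⟨?_, ?_, ?_, ?_, ?_⟩
  · -- (K0)
    intro y z
    exact mul_nonneg (inv_nonneg.mpr hcIpos.le) (Finset.sum_nonneg fun a _ => h0 _ _)
  · -- (K1): fiberwise count (one coarse plaquette) × column sum of `K`
    intro y z
    have hfib := sum_baseLL_le hi y μ ν (fun y' => K y' z) (fun y' => h0 y' z)
    calc cI⁻¹ * ∑ a ∈ A, K (shiftN (shiftN (Site.blockSite y a.1.1) μ a.2.1) ν a.2.2) z ≤ cI⁻¹ * (C * ∑ y', K y' z) :=
          mul_le_mul_of_nonneg_left hfib (inv_nonneg.mpr hcIpos.le)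
      _ = mP * ∑ y', K y' z := by rw [hmPC]; ring
      _ ≤ mP * mP ^ i := mul_le_mul_of_nonneg_left (h2 z) hmP0
      _ = mP ^ (i + 1) := by ring
  · -- (K2): joint count (all coarse plaquettes) × column sum of `K`
    intro z
    have hjoint := sum_sum_baseLL_le hi μ ν (fun y' => K y' z) (fun y' => h0 y' z)
    calc ∑ y, cI⁻¹ * ∑ a ∈ A, K (shiftN (shiftN (Site.blockSite y a.1.1) μ a.2.1) ν a.2.2) z
        = cI⁻¹ * ∑ y, ∑ a ∈ A, K (shiftN (shiftN (Site.blockSite y a.1.1) μ a.2.1) ν a.2.2) z := by rw [Finset.mul_sum]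
      _ ≤ cI⁻¹ * (C * ∑ y', K y' z) := mul_le_mul_of_nonneg_left hjoint (inv_nonneg.mpr hcIpos.le)
      _ = mP * ∑ y', K y' z := by rw [hmPC]; ring
      _ ≤ mP * mP ^ i := mul_le_mul_of_nonneg_left (h2 z) hmP0
      _ = mP ^ (i + 1) := by ring
  · -- (K3): row sums
    intro y
    rw [← Finset.mul_sum, Finset.sum_comm]
    calc cI⁻¹ * ∑ a ∈ A, ∑ z, K (shiftN (shiftN (Site.blockSite y a.1.1) μ a.2.1) ν a.2.2) z
        = cI⁻¹ * ∑ a ∈ A, ((P.L : ℝ) ^ 2) ^ i := by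
          congr 1; exact Finset.sum_congr rfl fun a _ => h3 _
      _ = cI⁻¹ * (A.card * ((P.L : ℝ) ^ 2) ^ i) := by rw [Finset.sum_const, nsmul_eq_mul]
      _ = ((P.L : ℝ) ^ 2) ^ (i + 1) := by
          rw [hcardA]; field_simp; ring
  · -- (K4): support
    intro y z h κ
    replace h : cI⁻¹ * ∑ a ∈ A, K (shiftN (shiftN (Site.blockSite y a.1.1) μ a.2.1) ν a.2.2) z ≠ 0 := h
    have hne : ∑ a ∈ A, K (shiftN (shiftN (Site.blockSite y a.1.1) μ a.2.1) ν a.2.2) z ≠ 0 := by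
      intro h0'; exact h (by rw [h0', mul_zero])
    obtain ⟨a, ha, hKa⟩ := Finset.exists_ne_zero_of_sum_ne_zero hne
    have hst := hmem a ha
    have hw := h4 _ z hKa
    rw [blockIter_succ]
    exact natAbs_rel_blockOf_le_two_of_baseLL hi y hμν a.1.1 hst.1 hst.2 (blockIter i z) hw κ

end Step

/-! ## §2 The family with its recursion identity -/

section Family

/-- ★★★ **THE COMPOSED DILUTION KERNELS AS ONE FAMILY** (orientation `μ ≠ ν`, `r ≤ m + K`): `K : (i : ℕ) → Site P i → Site P 0 → ℝ` with `K 0 = δ`, the RECURSION IDENTITY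
`K (i+1) y z = |I|⁻¹·Σ_a K i (x_a(y)) z` for `i < r`, and (K0)–(K4) at every `i ≤ r` — built by `Nat.rec`, the properties by §1.
[cite: Balaban1985Averaging, (19)-(20) p.21, Prop. 1 (51) p.26; Balaban1987RG1, (0.1)-(0.4) pp.251-253] -/
theorem exists_kernelFamily {μ ν : Fin P.d} (hμν : μ ≠ ν) (r : ℕ) (hr : r ≤ P.m + P.K) :
    ∃ K : (i : ℕ) → Site P i → Site P 0 → ℝ,
      (∀ (y : Site P 0) (z : Site P 0), K 0 y z = if y = z then 1 else 0) ∧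
      (∀ i, i < r → ∀ (y : Site P (i + 1)) (z : Site P 0), K (i + 1) y z = (Fintype.card (Idx P) : ℝ)⁻¹ *
          ∑ a ∈ (Finset.univ : Finset (Idx P)) ×ˢ (Finset.range P.L ×ˢ Finset.range P.L), K i (shiftN (shiftN (Site.blockSite y a.1.1) μ a.2.1) ν a.2.2) z) ∧
      (∀ i, i ≤ r →
        (∀ y z, 0 ≤ K i y z) ∧
        (∀ y z, K i y z ≤ ((((Fintype.card (Equiv.Perm (Fin P.d))) ^ 2 * P.L ^ 2 : ℕ) : ℝ) / (Fintype.card (Idx P) : ℝ)) ^ i) ∧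
        (∀ z, ∑ y, K i y z ≤ ((((Fintype.card (Equiv.Perm (Fin P.d))) ^ 2 * P.L ^ 2 : ℕ) : ℝ) / (Fintype.card (Idx P) : ℝ)) ^ i) ∧
        (∀ y, ∑ z, K i y z = ((P.L : ℝ) ^ 2) ^ i) ∧
        (∀ y z, K i y z ≠ 0 → ∀ κ, (rel y (blockIter i z) κ).natAbs ≤ 2)) := by
  classical
  refine ⟨fun i => Nat.rec (motive := fun i => Site P i → Site P 0 → ℝ) (fun y z => if y = z then 1 else 0)
      (fun i Ki => fun y z => (Fintype.card (Idx P) : ℝ)⁻¹ *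
        ∑ a ∈ (Finset.univ : Finset (Idx P)) ×ˢ (Finset.range P.L ×ˢ Finset.range P.L), Ki (shiftN (shiftN (Site.blockSite y a.1.1) μ a.2.1) ν a.2.2) z) i,
    fun y z => rfl, fun i _ y z => rfl, ?_⟩
  intro i hi
  induction i with
  | zero =>
      refine ⟨?_, ?_, ?_, ?_, ?_⟩
      · intro y z; show (0 : ℝ) ≤ (if y = z then 1 else 0); split_ifs <;> norm_num
      · intro y z; show (if y = z then (1 : ℝ) else 0) ≤ _; rw [pow_zero]; split_ifs <;> norm_num
      · intro z
        show ∑ y, (if y = z then (1 : ℝ) else 0) ≤ _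
        rw [pow_zero, Finset.sum_ite_eq', if_pos (Finset.mem_univ _)]
      · intro y
        show ∑ z, (if y = z then (1 : ℝ) else 0) = _
        rw [pow_zero, Finset.sum_ite_eq, if_pos (Finset.mem_univ _)]
      · intro y z h κ
        have hyz : y = z := by
          by_contra hne; exact h (show (if y = z then (1 : ℝ) else 0) = 0 by rw [if_neg hne])
        subst hyz; rw [blockIter_zero, rel_self]; simp
  | succ i ih =>
      obtain ⟨g0, -, g2, g3, g4⟩ := ih (Nat.le_of_succ_le hi)
      exact kernel_step hμν (hi.trans hr) _ g0 g2 g3 g4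

end Family

/-! ## §3 Superposition: rows with sources are dominated by the sum of per-level solutions -/

section Superposition

/-- ★★ **SUPERPOSITION**: a family obeying the lower-left rows with sources lies below the sum over source levels of any SUPER-SOLUTIONS of the pure rows started at those
levels (`P 0` from the data `ρ 0`, `P j` from `src j`): `ρ n y ≤ Σ_{j ≤ n} P j n y` — the rows are monotone with a nonnegative averaging operator. [cite: Balaban1985Averaging, (19)-(20) p.21] -/
theorem superposition_le {μ ν : Fin P.d} (ρ src : (k : ℕ) → Site P k → ℝ) (Psol : ℕ → (k : ℕ) → Site P k → ℝ) :
    ∀ n : ℕ,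
      (∀ k, k < n → ∀ y : Site P (k + 1), ρ (k + 1) y ≤ (Fintype.card (Idx P) : ℝ)⁻¹ *
          ∑ a ∈ (Finset.univ : Finset (Idx P)) ×ˢ (Finset.range P.L ×ˢ Finset.range P.L), ρ k (shiftN (shiftN (Site.blockSite y a.1.1) μ a.2.1) ν a.2.2) + src (k + 1) y) →
      (∀ y, ρ 0 y ≤ Psol 0 0 y) →
      (∀ j, 1 ≤ j → j ≤ n → ∀ y, src j y ≤ Psol j j y) →
      (∀ j k, j ≤ k → k < n → ∀ y : Site P (k + 1), (Fintype.card (Idx P) : ℝ)⁻¹ *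
          ∑ a ∈ (Finset.univ : Finset (Idx P)) ×ˢ (Finset.range P.L ×ˢ Finset.range P.L), Psol j k (shiftN (shiftN (Site.blockSite y a.1.1) μ a.2.1) ν a.2.2) ≤
        Psol j (k + 1) y) →
      ∀ y : Site P n, ρ n y ≤ ∑ j ∈ Finset.range (n + 1), Psol j n y := by
  intro n
  induction n with
  | zero =>
      intro _ h0 _ _ y
      rw [zero_add, Finset.sum_range_one]
      exact h0 y
  | succ n ih =>
      intro hrow h0 hsrc hP y
      have hcI : (0 : ℝ) ≤ (Fintype.card (Idx P) : ℝ)⁻¹ := inv_nonneg.mpr (Nat.cast_nonneg _)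
      have ih' := ih (fun k hk y' => hrow k (by omega) y') h0 (fun j hj1 hjn y' => hsrc j hj1 (by omega) y')
        (fun j k hjk hkn y' => hP j k hjk (by omega) y')
      -- the row at the top, the induction hypothesis under the average, the sources at the top
      have step1 : ρ (n + 1) y ≤ (Fintype.card (Idx P) : ℝ)⁻¹ *
          ∑ a ∈ (Finset.univ : Finset (Idx P)) ×ˢ (Finset.range P.L ×ˢ Finset.range P.L),
            (∑ j ∈ Finset.range (n + 1), Psol j n (shiftN (shiftN (Site.blockSite y a.1.1) μ a.2.1) ν a.2.2)) + Psol (n + 1) (n + 1) y := by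
        refine (hrow n (Nat.lt_succ_self n) y).trans (add_le_add ?_ (hsrc (n + 1) (by omega) le_rfl y))
        exact mul_le_mul_of_nonneg_left (Finset.sum_le_sum fun a _ => ih' _) hcI
      have step2 : (Fintype.card (Idx P) : ℝ)⁻¹ *
          ∑ a ∈ (Finset.univ : Finset (Idx P)) ×ˢ (Finset.range P.L ×ˢ Finset.range P.L),
            (∑ j ∈ Finset.range (n + 1), Psol j n (shiftN (shiftN (Site.blockSite y a.1.1) μ a.2.1) ν a.2.2)) =
          ∑ j ∈ Finset.range (n + 1), (Fintype.card (Idx P) : ℝ)⁻¹ *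
            ∑ a ∈ (Finset.univ : Finset (Idx P)) ×ˢ (Finset.range P.L ×ˢ Finset.range P.L), Psol j n (shiftN (shiftN (Site.blockSite y a.1.1) μ a.2.1) ν a.2.2) := by
        rw [Finset.sum_comm, Finset.mul_sum]
      have step3 : ∑ j ∈ Finset.range (n + 1), (Fintype.card (Idx P) : ℝ)⁻¹ *
            ∑ a ∈ (Finset.univ : Finset (Idx P)) ×ˢ (Finset.range P.L ×ˢ Finset.range P.L), Psol j n (shiftN (shiftN (Site.blockSite y a.1.1) μ a.2.1) ν a.2.2) ≤
          ∑ j ∈ Finset.range (n + 1), Psol j (n + 1) y :=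
        Finset.sum_le_sum fun j hj => hP j n (by rw [Finset.mem_range] at hj; omega) (Nat.lt_succ_self n) y
      rw [Finset.sum_range_succ]
      linarith [step1, step2, step3]

/-- ★ **KERNEL-PROPAGATED DATA SOLVE THE PURE ROWS EXACTLY**: with §2's recursion identity, `y ↦ Σ_z K k y z·s z` started from any level-0 data `s` satisfies
`|I|⁻¹·Σ_a (Σ_z K k (x_a(y)) z·s z) = Σ_z K (k+1) y z·s z`. [cite: Balaban1985Averaging, (19)-(20) p.21] -/
theorem kernelSolution_row {μ ν : Fin P.d} (K : (i : ℕ) → Site P i → Site P 0 → ℝ) {r : ℕ}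
    (hrec : ∀ i, i < r → ∀ (y : Site P (i + 1)) (z : Site P 0), K (i + 1) y z = (Fintype.card (Idx P) : ℝ)⁻¹ *
        ∑ a ∈ (Finset.univ : Finset (Idx P)) ×ˢ (Finset.range P.L ×ˢ Finset.range P.L), K i (shiftN (shiftN (Site.blockSite y a.1.1) μ a.2.1) ν a.2.2) z)
    (s : Site P 0 → ℝ) (k : ℕ) (hk : k < r) (y : Site P (k + 1)) :
    (Fintype.card (Idx P) : ℝ)⁻¹ *
        ∑ a ∈ (Finset.univ : Finset (Idx P)) ×ˢ (Finset.range P.L ×ˢ Finset.range P.L),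
          (∑ z, K k (shiftN (shiftN (Site.blockSite y a.1.1) μ a.2.1) ν a.2.2) z * s z) =
      ∑ z, K (k + 1) y z * s z := by
  rw [Finset.sum_comm, Finset.mul_sum]
  refine Finset.sum_congr rfl fun z _ => ?_
  rw [hrec k hk y z, ← Finset.sum_mul, mul_assoc]

end Superposition

end Summit.QuantumFields.YangMills.Theorems.FluctuationComparisonRegPrIntLS2BetaComposedDilutionKernelFamily

end
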